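import Summits.BirchSwinnertonDyer.BirchSwinnertonDyer.Theorems.ByReductionTypeAtTwoMultLowerHalfPrint
import Summits.BirchSwinnertonDyer.BirchSwinnertonDyer.Theorems.ByReductionTypeAtTwoMultLowerHalfShape
import Summits.BirchSwinnertonDyer.BirchSwinnertonDyer.Theorems.ByReductionTypeAtTwoOrdEisensteinHalfShaIsogeny
import Summits.BirchSwinnertonDyer.Rank1Residual.X2.IsogenyQuotientLine
import Literature.NumberTheory.EllipticCurves.IsogenyIdProofs
import Summits.BirchSwinnertonDyer.BirchSwinnertonDyer.Theorems.TwoAdicConverseMultCycDefs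
import Summits.BirchSwinnertonDyer.BirchSwinnertonDyer.Theorems.ByReductionTypeAtTwoMultiplicativeInputs
import HarnessLib

/-!
# Route `ByReductionTypeAtTwo`, layer-2 child `MultLowerHalfAtTwo` (item stmt-BirchSwinnertonDyer-19923):
# the item is an ISOGENY-CLASS statement, and its research object may be asked UP TO ISOGENY

Cell `bsd-2adic`, seat `bsd-2adic-mult-3` GEN 5 (D-0074 (A) row «find: 19923 `MultLowerHalfAtTwo`»).
THEOREMS ONLY — no definition, no named fact, nothing asserted, no class closed; BSD is not proved by
any of this. PARTITION (D-0054): X5@2 mult (K4ᵐ, RESIDUAL-MAP B1·O1; 1 976 book230 classes) × p = 2 —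
types-the-object-of (item 19923: the isogeny-class form of the item and of its WALL); closes none.

WHAT THIS FILE DOES. The item `MultLowerHalfAtTwo` is `∀ W` (non-CM, analytic rank `0`, multiplicative
at `2`): `ord₂ #Ш_an(E) ≤ ord₂ #Ш(E)[2^∞]` (`Typed.MissingLowerBoundAt W 2`). Seat GEN 0–4 reduced it to
PRINT {Greenberg's Thm-4.1 analogues at a multiplicative prime (guarded non-split twin `h41ns`, split
`h41sp`), modularity, Gross–Zagier–Kolyvagin, Greenberg's Thm. 1.5 (Kato–Rohrlich)} + MEMO
{Greenberg–Stevens at a split `2`} + ONE research object asked AT `W` ITSELF: the integral Eisenstein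
direction of the `2`-adic main conjecture at a multiplicative `2`, `X5.O1.MultEisensteinDivisibilityAtTwo W`
(T-mult-4-int; `multLowerHalfAtTwo_of_multEisenstein_of_cotorsion`, conv-2 GEN 4, p432673). Here:

* §1 `mult_two_of_isIsogenous`, `analyticRank_eq_zero_of_isIsogenous` — the item's binders transport
  along `ℚ`-isogenies (tree theorems: `X2.IsogenyQuotientLine.hasMultiplicativeReductionAtPrime_of_isIsogenous`,
  `analyticRank_eq_of_isIsogenous'`; the `¬CM` binder is idle, `not_hasCM_of_hasMultiplicativeReductionAtPrime'`).
* §2 **the item is an ISOGENY-CLASS statement**: granted PRINT {Cassels' isogeny invariance of the BSD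
  quotient `bsdRHS_eq_of_isIsogenous`, GZK, modularity}, `MissingLowerBoundAt · 2` at analytic rank `0`
  is constant on `ℚ`-isogeny classes (`missingLowerBoundAt_two_iff_of_isIsogenous`, both directions, from
  ord-3's one-way transport `EisensteinShaCurrency.missingLowerBoundAt_two_of_isIsogenous`), hence
  `multLowerHalfAtTwo_iff_upToIsogeny`: the item ⟺ «every non-CM rank-`0` multiplicative-at-`2` curve has
  SOME `ℚ`-isogenous globally minimal member satisfying the descent inequality».
* §3 **the research object may be asked UP TO ISOGENY ((β)-hedge)**: per pair
  (`missingLowerBoundAt_two_of_isIsogenous_multEisenstein_of_thm15`) and ∀-closed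
  (`multLowerHalfAtTwo_of_multEisensteinIso_of_cotorsion`): the route decl `MultLowerHalfAtTwo` follows
  from PRINT {`h41ns`, `h41sp`, modularity, GZK, Thm. 1.5, Cassels} + MEMO {GS at a split `2`} + the
  ISOGENY-HEDGED object «for every non-CM `W` multiplicative at `2`, SOME `ℚ`-isogenous globally minimal
  `W'` multiplicative at `2` satisfies `X5.O1.MultEisensteinDivisibilityAtTwo W'`» — VERBATIM the research
  stub `stub_multEisensteinIso` of conv-2's line `cycint` on crux 19187 (route `TwoAdicConverse`): ONE
  research object now serves K4ᵐ-lower (19923) and S3ᵐ (19187/19219). The hedge removes from the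
  object's risk the `μ`-isogeny formula at `p = 2` (Schneider / Perrin-Riou print it for odd `p` only;
  Greenberg LNM 1716 p. 64), exactly as the director's (β) ruling did for 19271 → 19573.
* §4 the sign-split, rank-`0` forms used by the LINE `two_halves` of this item (`…_bySign`), and the
  bookkeeping that the member-wise object of GEN 0–4 implies the hedged ones (`isIsogenous_self`).
* §5 (second landing) glue BY NAME over conv-2's cyclotomic carrier leaves: `multLowerHalfAtTwo_of_cycChildrenIso`
  (19923 from `TwoAdicMultCyc.MultEisensteinHalfAtTwoIso`) and `multiplicativeRankZeroAtTwo_of_childrenK4MIso` (the parent 19096).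

What this is NOT: a proof of 19923 (the hedged object is open at `p = 2` like the member-wise one: Skinner
2016 Thm. A/B `p ≥ 3`, Skinner–Urban 2014 `p` odd); not a statement that the member-wise and hedged
objects are equivalent (that IS the unprinted `μ`-isogeny formula at `2`); nothing booked.
[cite: Cassels1965ArithmeticVIII, Thm. 1.1 (isogeny invariance of the BSD quotient)] [cite: MilneADT2006, Thm. I.7.3]
[cite: GreenbergLNM1716, Thm. 1.5 (p. 61), §4 pp. 112–113, and p. 64 (μ under isogeny, odd p)]
[cite: Skinner2016PacificMC, Thm. A and Thm. B (§1; p ≥ 3; shape only)] [cite: Miller2011LMS, Def. 1.1]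
[cite: SilvermanAEC2009, Cor. VII.7.2 and §C.16]
-/

set_option autoImplicit false
-- the route's Theorems namespace repeats a component by design (summit = sub-problem, D-0017).
set_option linter.dupNamespace false

noncomputable section

open scoped Classical

open WeierstrassCurve Literature.NumberTheory.EllipticCurves
  Literature.NumberTheory.EllipticCurves.ModularForms
  Literature.NumberTheory.EllipticCurves.Greenberg1999
  Literature.NumberTheory.EllipticCurves.Rank1Residual
  Literature.NumberTheory.EllipticCurves.Rank1Residual.Typed
  Summit.BirchSwinnertonDyer.Rank1Residual.X5

namespace Summit.BirchSwinnertonDyer.BirchSwinnertonDyer.Theorems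

/-! ## §1 The item's binders transport along `ℚ`-isogenies -/

/-- **Multiplicative reduction at `2` is a `ℚ`-isogeny invariant** (in the item's vocabulary
`Rank1Residual.Mult W 2`): the tree theorem
`X2.IsogenyQuotientLine.hasMultiplicativeReductionAtPrime_of_isIsogenous` (Silverman AEC VII.7.2 /
§C.16, read at the place above `2`). Bookkeeping. [cite: SilvermanAEC2009, Cor. VII.7.2 and §C.16] -/
theorem mult_two_of_isIsogenous {W W' : WeierstrassCurve ℚ} [W.IsElliptic] [W'.IsElliptic]
    (hiso : IsIsogenous W W') (hmult : Mult W 2) : Mult W' 2 :=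
  Summit.BirchSwinnertonDyer.Rank1Residual.X2.IsogenyQuotientLine.hasMultiplicativeReductionAtPrime_of_isIsogenous
    hiso hmult

/-- **Split multiplicative reduction at `2` is a `ℚ`-isogeny invariant** (`a₂(E) = a₂(E')`): the tree
theorem `X2.IsogenyQuotientLine.hasSplitMultiplicativeReductionAtPrime_iff_of_isIsogenous`.
Bookkeeping. [cite: SilvermanAEC2009, §C.16 (definition of L_v(T))] -/
theorem hasSplitMultiplicativeReductionAtPrime_two_iff_of_isIsogenous {W W' : WeierstrassCurve ℚ}
    [W.IsElliptic] [W'.IsElliptic] (hiso : IsIsogenous W W') :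
    W.HasSplitMultiplicativeReductionAtPrime 2 ↔ W'.HasSplitMultiplicativeReductionAtPrime 2 :=
  Summit.BirchSwinnertonDyer.Rank1Residual.X2.IsogenyQuotientLine.hasSplitMultiplicativeReductionAtPrime_iff_of_isIsogenous
    hiso

/-- **Analytic rank `0` is a `ℚ`-isogeny invariant** (equal `L`-functions, Faltings / Knapp Thm. 11.67;
tree theorem `analyticRank_eq_of_isIsogenous'`). Bookkeeping. [cite: Knapp1993, Thm. 11.67] -/
theorem analyticRank_eq_zero_of_isIsogenous {W W' : WeierstrassCurve ℚ} [W.IsElliptic] [W'.IsElliptic]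
    (hiso : IsIsogenous W W') (hr : W.analyticRank = 0) : W'.analyticRank = 0 := by
  rw [← analyticRank_eq_of_isIsogenous' hiso, hr]

/-! ## §2 The item is an isogeny-class statement -/

/-- **The descent inequality at `2` is constant on `ℚ`-isogeny classes of analytic rank `0`** (both
directions). For `ℚ`-isogenous globally minimal `W ∼ W'` with `r_an(W) = 0`, granted PRINT {Cassels'
isogeny invariance of the BSD quotient `hCassels`, Gross–Zagier–Kolyvagin `hGZK` (finiteness of `Ш`),
modularity `hmod` (`L(E,1) ≠ 0` at analytic rank `0`)}: `MissingLowerBoundAt W 2 ↔ MissingLowerBoundAt W' 2`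
— `ord₂ #Ш − ord₂ #Ш_an` is an isogeny invariant (ord-3 GEN 2, `EisensteinShaCurrency.missingLowerBoundAt_two_of_isIsogenous`,
applied both ways with `IsIsogenous.symm_of_charZero`). [cite: Cassels1965ArithmeticVIII, Thm. 1.1]
[cite: MilneADT2006, Thm. I.7.3] [cite: Miller2011LMS, Def. 1.1 and §1] -/
theorem missingLowerBoundAt_two_iff_of_isIsogenous (hCassels : bsdRHS_eq_of_isIsogenous)
    (hGZK : rank_eq_analyticRank_of_analyticRank_le_one) (hmod : nonempty_modularParametrizationData)
    {W W' : WeierstrassCurve ℚ} [W.IsElliptic] [W.IsGloballyMinimal] [W'.IsElliptic]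
    [W'.IsGloballyMinimal] (hiso : IsIsogenous W W') (hr : W.analyticRank = 0) :
    MissingLowerBoundAt W 2 ↔ MissingLowerBoundAt W' 2 :=
  ⟨fun h => EisensteinShaCurrency.missingLowerBoundAt_two_of_isIsogenous W' hCassels hGZK hmod
      (analyticRank_eq_zero_of_isIsogenous hiso hr) hiso.symm_of_charZero h,
    fun h => EisensteinShaCurrency.missingLowerBoundAt_two_of_isIsogenous W hCassels hGZK hmod hr hiso h⟩

/-- **Item 19923 is an ISOGENY-CLASS statement.** Granted PRINT {Cassels `hCassels`, GZK `hGZK`,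
modularity `hmod`}, the route's child `MultLowerHalfAtTwo` is EQUIVALENT to: «every non-CM globally
minimal `W` of analytic rank `0` multiplicative at `2` has SOME `ℚ`-isogenous globally minimal `W'` with
`ord₂ #Ш_an(W') ≤ ord₂ #Ш(W')[2^∞]`». (⇒: `W' = W`, `isIsogenous_self`; ⇐: transport §2.) So a per-class
certificate or a per-class main-conjecture input at ANY member serves every member; the item asks ONE
inequality per isogeny class. Bookkeeping equivalence; the item stays OPEN. [cite: Cassels1965ArithmeticVIII, Thm. 1.1]
[cite: MilneADT2006, Thm. I.7.3] [cite: Miller2011LMS, Def. 1.1 and §1] -/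
theorem multLowerHalfAtTwo_iff_upToIsogeny (hCassels : bsdRHS_eq_of_isIsogenous)
    (hGZK : rank_eq_analyticRank_of_analyticRank_le_one) (hmod : nonempty_modularParametrizationData) :
    Summit.BirchSwinnertonDyer.BirchSwinnertonDyer.Theses.ByReductionTypeAtTwo.MultLowerHalfAtTwo ↔
      ∀ (W : WeierstrassCurve ℚ) [W.IsElliptic] [W.IsGloballyMinimal], ¬ W.HasCM → W.analyticRank = 0 →
        Mult W 2 → ∃ (W' : WeierstrassCurve ℚ) (_ : W'.IsElliptic) (_ : W'.IsGloballyMinimal),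
          IsIsogenous W W' ∧ MissingLowerBoundAt W' 2 := by
  unfold Summit.BirchSwinnertonDyer.BirchSwinnertonDyer.Theses.ByReductionTypeAtTwo.MultLowerHalfAtTwo
  constructor
  · intro h W _ _ hcm hr hmult
    exact ⟨W, inferInstance, inferInstance, isIsogenous_self W, h W hcm hr hmult⟩
  · intro h W _ _ hcm hr hmult
    obtain ⟨W', _, _, hiso, h'⟩ := h W hcm hr hmult
    exact (missingLowerBoundAt_two_iff_of_isIsogenous hCassels hGZK hmod hiso hr).mpr h'

/-! ## §3 The research object asked UP TO ISOGENY ((β)-hedge) -/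

/-- **Per pair: the lower half at `W` from T-mult-4-int at ANY isogenous member `W'` (PROVED).** `W`
globally minimal of analytic rank `0`; `W ∼ W'` a `ℚ`-isogeny to a globally minimal `W'` multiplicative
at `2` carrying `X5.O1.MultEisensteinDivisibilityAtTwo W'`; PRINT {guarded Thm-4.1 non-split analogue
`h41ns`, A236 `h41sp`, modularity, GZK, Thm. 1.5 `h15`, Cassels `hCassels`} and, if `W'` is split at
`2`, Greenberg–Stevens at `2` for `W'` (`hGS'`, MEMO). Then `MissingLowerBoundAt W 2`:
`r_an(W') = 0` (§1), the K11-free per-pair lower half at `W'`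
(`missingLowerBoundAt_two_of_multEisenstein_of_greenberg'_of_thm15`, p432673), transported to `W` (§2).
[cite: GreenbergLNM1716, Thm. 1.5 (p. 61) and §4 pp. 112–113] [cite: Cassels1965ArithmeticVIII, Thm. 1.1]
[cite: Miller2011LMS, Def. 1.1 and §1] -/
theorem missingLowerBoundAt_two_of_isIsogenous_multEisenstein_of_thm15
    (W : WeierstrassCurve ℚ) [W.IsElliptic] [W.IsGloballyMinimal]
    (h41ns : thm41Analogue_charValue_rankZero_numberField_anyPrime_oddLocalDegree)
    (h41sp : thm41Analogue_charValue_rankZero_split_baseChange_anyPrime)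
    (hmod : nonempty_modularParametrizationData)
    (hGZK : rank_eq_analyticRank_of_analyticRank_le_one)
    (h15 : thm15_isTorsion_multiplicative_rat)
    (hCassels : bsdRHS_eq_of_isIsogenous)
    (hr : W.analyticRank = 0) {W' : WeierstrassCurve ℚ} [W'.IsElliptic] [W'.IsGloballyMinimal]
    (hiso : IsIsogenous W W') (hmult' : Mult W' 2)
    (hGS' : W'.HasSplitMultiplicativeReductionAtPrime 2 → greenberg_stevens (W := W') (p := 2))
    (h' : O1.MultEisensteinDivisibilityAtTwo W') : MissingLowerBoundAt W 2 :=
  EisensteinShaCurrency.missingLowerBoundAt_two_of_isIsogenous W hCassels hGZK hmod hr hiso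
    (missingLowerBoundAt_two_of_multEisenstein_of_greenberg'_of_thm15 W' h41ns h41sp hmod hGZK h15 hGS'
      (analyticRank_eq_zero_of_isIsogenous hiso hr) hmult' h')

/-- **Bridge ((β)-hedged T-mult-4-int ⇒ the lower half, item 19923), K11-FREE.** PRINT {the guarded
Thm-4.1 analogue at a non-split multiplicative prime (`h41ns`), A236 (`h41sp`), modularity (`hmod`), GZK
(`hGZK`), Greenberg's Thm. 1.5 (`h15`), Cassels' isogeny invariance of the BSD quotient (`hCassels`)} +
MEMO {Greenberg–Stevens at a split `2` (`hGS`)} + the ISOGENY-HEDGED research object `hEiso` — for every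
non-CM globally minimal `W` multiplicative at `2`, SOME `ℚ`-isogenous globally minimal `W'` multiplicative
at `2` satisfies `X5.O1.MultEisensteinDivisibilityAtTwo W'` (VERBATIM the research stub
`stub_multEisensteinIso` of conv-2's line `cycint` on crux 19187) — imply the route's child
`MultLowerHalfAtTwo`. Weaker hypothesis than `multLowerHalfAtTwo_of_multEisenstein_of_cotorsion` (p432673:
the object at `W` itself), same conclusion: the `μ`-isogeny formula at `p = 2` (not in print) is no longer
on the road. Composition certificate; nothing asserted; the item stays OPEN with the hedged object.
[cite: GreenbergLNM1716, Thm. 1.5 (p. 61), §4 pp. 112–113, p. 64] [cite: Cassels1965ArithmeticVIII, Thm. 1.1]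
[cite: Skinner2016PacificMC, Thm. A and Thm. B (shape; p ≥ 3)] [cite: Miller2011LMS, Def. 1.1] -/
theorem multLowerHalfAtTwo_of_multEisensteinIso_of_cotorsion
    (h41ns : thm41Analogue_charValue_rankZero_numberField_anyPrime_oddLocalDegree)
    (h41sp : thm41Analogue_charValue_rankZero_split_baseChange_anyPrime)
    (hmod : nonempty_modularParametrizationData)
    (hGZK : rank_eq_analyticRank_of_analyticRank_le_one)
    (h15 : thm15_isTorsion_multiplicative_rat)
    (hCassels : bsdRHS_eq_of_isIsogenous)
    (hGS : ∀ (W : WeierstrassCurve ℚ) [W.IsElliptic] [W.IsGloballyMinimal],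
      W.HasSplitMultiplicativeReductionAtPrime 2 → greenberg_stevens (W := W) (p := 2))
    (hEiso : ∀ (W : WeierstrassCurve ℚ) [W.IsElliptic] [W.IsGloballyMinimal], ¬ W.HasCM → Mult W 2 →
      ∃ (W' : WeierstrassCurve ℚ) (_ : W'.IsElliptic) (_ : W'.IsGloballyMinimal),
        IsIsogenous W W' ∧ Mult W' 2 ∧ O1.MultEisensteinDivisibilityAtTwo W') :
    Summit.BirchSwinnertonDyer.BirchSwinnertonDyer.Theses.ByReductionTypeAtTwo.MultLowerHalfAtTwo := by
  unfold Summit.BirchSwinnertonDyer.BirchSwinnertonDyer.Theses.ByReductionTypeAtTwo.MultLowerHalfAtTwo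
  intro W _ _ hcm hr hmult
  obtain ⟨W', _, _, hiso, hmult', h'⟩ := hEiso W hcm hmult
  exact missingLowerBoundAt_two_of_isIsogenous_multEisenstein_of_thm15 W h41ns h41sp hmod hGZK h15
    hCassels hr hiso hmult' (hGS W') h'

/-! ## §4 The sign-split rank-`0` forms (the stubs of LINE `two_halves`) and the α ⇒ β bookkeeping -/

/-- **Bridge for the LINE `two_halves` of item 19923 (sign-split, rank-`0`, (β)-hedged).** PRINT ×6
{`h41ns`, `h41sp`, `hmod`, `hGZK`, `h15`, `hCassels`} + MEMO {`hGS`: Greenberg–Stevens at a split `2`} +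
WALL × 2: `hEns` — every non-CM globally minimal `W` of analytic rank `0` with NON-SPLIT multiplicative
reduction at `2` has SOME `ℚ`-isogenous globally minimal `W'` multiplicative at `2` with
`X5.O1.MultEisensteinDivisibilityAtTwo W'` (the ordinary-type Eisenstein divisibility `ϖ·L₂ ∣ f_X`, no
trivial zero; after Thm. 1.5 its road is PRINT-only) — and `hEsp` — the same for SPLIT multiplicative
reduction at `2` (`ϖ·L₂ ∣ T·f_X`, the trivial zero charged to `T`; its road carries the MEMO input GS at
`2`) ⇒ the route's child `MultLowerHalfAtTwo`. One case split on the sign at `W`, then §3.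
Composition certificate; nothing asserted. [cite: GreenbergLNM1716, Thm. 1.5 (p. 61) and §4 pp. 112–113]
[cite: Cassels1965ArithmeticVIII, Thm. 1.1] [cite: Miller2011LMS, Def. 1.1] -/
theorem multLowerHalfAtTwo_of_multEisensteinIso_bySign
    (h41ns : thm41Analogue_charValue_rankZero_numberField_anyPrime_oddLocalDegree)
    (h41sp : thm41Analogue_charValue_rankZero_split_baseChange_anyPrime)
    (hmod : nonempty_modularParametrizationData)
    (hGZK : rank_eq_analyticRank_of_analyticRank_le_one)
    (h15 : thm15_isTorsion_multiplicative_rat)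
    (hCassels : bsdRHS_eq_of_isIsogenous)
    (hGS : ∀ (W : WeierstrassCurve ℚ) [W.IsElliptic] [W.IsGloballyMinimal],
      W.HasSplitMultiplicativeReductionAtPrime 2 → greenberg_stevens (W := W) (p := 2))
    (hEns : ∀ (W : WeierstrassCurve ℚ) [W.IsElliptic] [W.IsGloballyMinimal], ¬ W.HasCM →
      W.analyticRank = 0 → Mult W 2 → ¬ W.HasSplitMultiplicativeReductionAtPrime 2 →
        ∃ (W' : WeierstrassCurve ℚ) (_ : W'.IsElliptic) (_ : W'.IsGloballyMinimal),
          IsIsogenous W W' ∧ Mult W' 2 ∧ O1.MultEisensteinDivisibilityAtTwo W')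
    (hEsp : ∀ (W : WeierstrassCurve ℚ) [W.IsElliptic] [W.IsGloballyMinimal], ¬ W.HasCM →
      W.analyticRank = 0 → Mult W 2 → W.HasSplitMultiplicativeReductionAtPrime 2 →
        ∃ (W' : WeierstrassCurve ℚ) (_ : W'.IsElliptic) (_ : W'.IsGloballyMinimal),
          IsIsogenous W W' ∧ Mult W' 2 ∧ O1.MultEisensteinDivisibilityAtTwo W') :
    Summit.BirchSwinnertonDyer.BirchSwinnertonDyer.Theses.ByReductionTypeAtTwo.MultLowerHalfAtTwo := by
  unfold Summit.BirchSwinnertonDyer.BirchSwinnertonDyer.Theses.ByReductionTypeAtTwo.MultLowerHalfAtTwo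
  intro W _ _ hcm hr hmult
  obtain ⟨W', _, _, hiso, hmult', h'⟩ :
      ∃ (W' : WeierstrassCurve ℚ) (_ : W'.IsElliptic) (_ : W'.IsGloballyMinimal),
        IsIsogenous W W' ∧ Mult W' 2 ∧ O1.MultEisensteinDivisibilityAtTwo W' := by
    by_cases hs : W.HasSplitMultiplicativeReductionAtPrime 2
    · exact hEsp W hcm hr hmult hs
    · exact hEns W hcm hr hmult hs
  exact missingLowerBoundAt_two_of_isIsogenous_multEisenstein_of_thm15 W h41ns h41sp hmod hGZK h15
    hCassels hr hiso hmult' (hGS W') h'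

/-- **α ⇒ β (bookkeeping).** The member-wise ∀-object of GEN 0–4's road (`hE`: T-mult-4-int at `W`
itself for every non-CM rank-`0` `W` multiplicative at `2`, the hypothesis of
`multLowerHalfAtTwo_of_multEisenstein_of_cotorsion`) implies BOTH sign-split hedged objects of the LINE
`two_halves` (take `W' = W`, `isIsogenous_self`). So the line's WALL is implied by, and a priori weaker
than, the old road's object; the converse would be the `μ`-isogeny formula at `p = 2` (not in print).
[cite: GreenbergLNM1716, p. 64 (μ under isogeny, odd p)] [cite: Skinner2016PacificMC, Thm. A and Thm. B (shape; p ≥ 3)] -/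
theorem multEisensteinIso_bySign_of_memberwise
    (hE : ∀ (W : WeierstrassCurve ℚ) [W.IsElliptic] [W.IsGloballyMinimal],
      ¬ W.HasCM → W.analyticRank = 0 → Mult W 2 → O1.MultEisensteinDivisibilityAtTwo W) :
    (∀ (W : WeierstrassCurve ℚ) [W.IsElliptic] [W.IsGloballyMinimal], ¬ W.HasCM →
      W.analyticRank = 0 → Mult W 2 → ¬ W.HasSplitMultiplicativeReductionAtPrime 2 →
        ∃ (W' : WeierstrassCurve ℚ) (_ : W'.IsElliptic) (_ : W'.IsGloballyMinimal),
          IsIsogenous W W' ∧ Mult W' 2 ∧ O1.MultEisensteinDivisibilityAtTwo W') ∧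
    (∀ (W : WeierstrassCurve ℚ) [W.IsElliptic] [W.IsGloballyMinimal], ¬ W.HasCM →
      W.analyticRank = 0 → Mult W 2 → W.HasSplitMultiplicativeReductionAtPrime 2 →
        ∃ (W' : WeierstrassCurve ℚ) (_ : W'.IsElliptic) (_ : W'.IsGloballyMinimal),
          IsIsogenous W W' ∧ Mult W' 2 ∧ O1.MultEisensteinDivisibilityAtTwo W') :=
  ⟨fun W _ _ hcm hr hmult _ => ⟨W, inferInstance, inferInstance, isIsogenous_self W, hmult, hE W hcm hr hmult⟩,
    fun W _ _ hcm hr hmult _ => ⟨W, inferInstance, inferInstance, isIsogenous_self W, hmult, hE W hcm hr hmult⟩⟩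

/-- **rank-free β ⇒ sign-split rank-`0` β (bookkeeping).** conv-2's stub `stub_multEisensteinIso`
(rank-free, sign-free) implies both WALL stubs of the LINE `two_halves` (drop the two idle hypotheses).
So ONE research object serves crux 19187 (S3ᵐ) and item 19923 (K4ᵐ-lower). [folklore] -/
theorem multEisensteinIso_bySign_of_multEisensteinIso
    (hEiso : ∀ (W : WeierstrassCurve ℚ) [W.IsElliptic] [W.IsGloballyMinimal], ¬ W.HasCM → Mult W 2 →
      ∃ (W' : WeierstrassCurve ℚ) (_ : W'.IsElliptic) (_ : W'.IsGloballyMinimal),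
        IsIsogenous W W' ∧ Mult W' 2 ∧ O1.MultEisensteinDivisibilityAtTwo W') :
    (∀ (W : WeierstrassCurve ℚ) [W.IsElliptic] [W.IsGloballyMinimal], ¬ W.HasCM →
      W.analyticRank = 0 → Mult W 2 → ¬ W.HasSplitMultiplicativeReductionAtPrime 2 →
        ∃ (W' : WeierstrassCurve ℚ) (_ : W'.IsElliptic) (_ : W'.IsGloballyMinimal),
          IsIsogenous W W' ∧ Mult W' 2 ∧ O1.MultEisensteinDivisibilityAtTwo W') ∧
    (∀ (W : WeierstrassCurve ℚ) [W.IsElliptic] [W.IsGloballyMinimal], ¬ W.HasCM →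
      W.analyticRank = 0 → Mult W 2 → W.HasSplitMultiplicativeReductionAtPrime 2 →
        ∃ (W' : WeierstrassCurve ℚ) (_ : W'.IsElliptic) (_ : W'.IsGloballyMinimal),
          IsIsogenous W W' ∧ Mult W' 2 ∧ O1.MultEisensteinDivisibilityAtTwo W') :=
  ⟨fun W _ _ hcm _ hmult _ => hEiso W hcm hmult, fun W _ _ hcm _ hmult _ => hEiso W hcm hmult⟩

/-! ## §5 Glue BY NAME over the cyclotomic carrier leaves (conv-2 GEN 4, `Theorems/TwoAdicConverseMultCycDefs.lean`,
p435033): K4ᵐ-lower and the K4ᵐ parent from the ISOGENY-HEDGED leaf `TwoAdicMultCyc.MultEisensteinHalfAtTwoIso`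

(appended, mult-3 GEN 5, second landing of this file.) conv-2's glue file (`TwoAdicConverseMultCycGlue.lean`, p436152) reads
S3ᵐ's 19219/19187 from the HEDGED leaf (`…_of_cycChildrenIso`) but K4ᵐ's 19923 only from the MEMBER-WISE leaf
(`multLowerHalfAtTwo_of_cycChildren`). With §3 the hedged leaf serves 19923 too, so ONE decl
(`TwoAdicMultCyc.MultEisensteinHalfAtTwoIso`) can be the shared research child of S3ᵐ and K4ᵐ-lower if a planner
rides the dormant rider K-7/S-2 (cell NEXT-ROUND.md; HOME/mult3/resplit-19923-K4M/). -/

/-- **K4ᵐ-lower BY NAME from the HEDGED leaf: `MultCycPublishedInputsAtTwo → GZK → Cassels →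
MultGreenbergStevensAtTwo → MultEisensteinHalfAtTwoIso → MultLowerHalfAtTwo`** (item 19923). One application of
`multLowerHalfAtTwo_of_multEisensteinIso_of_cotorsion` (§3); the PUB conjunction is conv-2's relocated Literature constant
(A235-twin ∧ A236 ∧ modularity ∧ Thm. 1.5), GZK and Cassels ride separately (they are the route's `MultPublishedInputsAtTwo`
and a conjunct of `OrdIsoPublishedInputsAtTwo`). Composition certificate; nothing asserted.
[cite: GreenbergLNM1716, Thm. 1.5 (p. 61) and §4 pp. 112–113] [cite: Cassels1965ArithmeticVIII, Thm. 1.1]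
[cite: Miller2011LMS, Def. 1.1] -/
theorem multLowerHalfAtTwo_of_cycChildrenIso
    (hP : Literature.NumberTheory.EllipticCurves.MultCycPublishedInputsAtTwo)
    (hGZK : rank_eq_analyticRank_of_analyticRank_le_one) (hCassels : bsdRHS_eq_of_isIsogenous)
    (hGS : TwoAdicMultCyc.MultGreenbergStevensAtTwo) (hE : TwoAdicMultCyc.MultEisensteinHalfAtTwoIso) :
    Summit.BirchSwinnertonDyer.BirchSwinnertonDyer.Theses.ByReductionTypeAtTwo.MultLowerHalfAtTwo :=
  multLowerHalfAtTwo_of_multEisensteinIso_of_cotorsion hP.1 hP.2.1 hP.2.2.1 hGZK hP.2.2.2 hCassels hGS hE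

/-- **The K4ᵐ PARENT BY NAME over the hedged leaf: `MultPublishedInputsAtTwo → (MultCycPublishedInputsAtTwo ∧ Cassels) →
MultUpperHalfAtTwo → MultGreenbergStevensAtTwo → MultEisensteinHalfAtTwoIso → MultiplicativeRankZeroAtTwo`** (item 19096) —
the re-glue a planner would file for rider K-7 with the SHARED hedged child: the halves bridge
`multiplicativeRankZeroAtTwo_of_halves` (p409679) fed with the route's upper-half child as served and the lower half from
`multLowerHalfAtTwo_of_cycChildrenIso`. Composition certificate; nothing asserted; no route edit implied.
[cite: GreenbergLNM1716, Thm. 1.5 (p. 61) and §4 pp. 112–113] [cite: Cassels1965ArithmeticVIII, Thm. 1.1]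
[cite: Miller2011LMS, Def. 1.1] -/
theorem multiplicativeRankZeroAtTwo_of_childrenK4MIso
    (hGZK : Summit.BirchSwinnertonDyer.BirchSwinnertonDyer.Theses.ByReductionTypeAtTwo.MultPublishedInputsAtTwo)
    (hP : Literature.NumberTheory.EllipticCurves.MultCycPublishedInputsAtTwo ∧ bsdRHS_eq_of_isIsogenous)
    (hU : Summit.BirchSwinnertonDyer.BirchSwinnertonDyer.Theses.ByReductionTypeAtTwo.MultUpperHalfAtTwo)
    (hGS : TwoAdicMultCyc.MultGreenbergStevensAtTwo) (hE : TwoAdicMultCyc.MultEisensteinHalfAtTwoIso) :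
    Summit.BirchSwinnertonDyer.BirchSwinnertonDyer.Theses.ByReductionTypeAtTwo.MultiplicativeRankZeroAtTwo :=
  multiplicativeRankZeroAtTwo_of_halves hGZK hU (multLowerHalfAtTwo_of_cycChildrenIso hP.1 hGZK hP.2 hGS hE)

end Summit.BirchSwinnertonDyer.BirchSwinnertonDyer.Theorems

end
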